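import Summits.QuantumFields.YangMills.Theorems.FluctuationComparisonRegPrIntLS2BetaRelativeFieldLetter
import Summits.QuantumFields.YangMills.Theorems.FluctuationComparisonRegPrIntLS2BetaArcBondSplit
import Summits.QuantumFields.YangMills.Theorems.FluctuationComparisonRegPrIntLS2BetaWhitneyHatLiftCurvature
import Literature.MathematicalPhysics.QuantumFieldTheory.Balaban1983to89.LatticeWordStokes
import Literature.MathematicalPhysics.QuantumFieldTheory.Balaban1983to89.BlockAveragingEMLProp2
import HarnessLib

/-!
# S2β · `hFlat` road (UV3-NODE §57.8 (B)) — THE RELATIVE STAGE TOWER STAYS IN THE CHART, WITH A CONTRACTING PROFILE: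
# the one-level SUP letter `s′_t ≤ L⁻¹·s′_{t+1} + ρ_t + C₂·s′_{t+1}²` from the landed relative letters, the hat lift and the correction factor

Cell `ym3-torus` (YM ladder rung R3 = continuum `SU(2)` Yang–Mills on the three-torus — a RUNG: NOT d = 4, NOT infinite volume, NOT a mass gap,
NOT Clay).  Width seat «width 17» `ym3-torus-px17` (gen 19), FREE px helper on crux `stmt-QuantumFields-20520`
(`Theses.UnitScaleTilt.FluctuationComparisonRegPrIntL`); `--kind proof --supports stmt-QuantumFields-20520 --as helper`, count-neutral, DEFINITION-FREE
(0 `def`, 0 `instance`, 0 `notation`, 0 `sorry`, default heartbeats).  GO px16 g20 08:10:12Z (✓p816141 (5)'s author, wishes (w1)(w2): (5)'s premise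
currency, height indexing) — this file is (5)'s LATTICE DOCKING («the identification of `ρ_t` with flux-class quantities and of `s` with the relative
tower's sup profile … NOT proved here», ✓p816141's honest block).

WHY (UV3-NODE §57.8 (B)∕(R2), §63.4, §64.3; ✓p816498 `…HFlatOfRelativeLetter`).  The (iv) recursion `B_t ≤ √L·(1 + ε_t)·B_{t+1} + R_t` has the flap
defect `ε_t ≍ C(L)·s′_{t+1}` with `s′` the SUP PROFILE OF THE RELATIVE STAGE TOWER (px12 g23's F₂ locate: the hat lift of a flat non-abelian field is not
flat; the commutator is SIZE × ARC), and EVERY feeder of ✓p816498's hypothesis (H) needs the gauged levels `U′_t` and the lifts `V_t` inside the BCH chart.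
px16 g20's FINDING (✓p816141): the relevant sizes are NOT the flat iterated-axial profile of ✓p814387 (whose sum is linear in the depth) but the relative
tower's, which CONTRACTS — comb bonds carry the lift (`arc (V b) ≤ L⁻¹·max arc`, (W3)), the other bonds add FLUXES.  This file proves that contraction,
one level at a time, from landed letters only:
* §1 `dist1_rect_one_one_le` (a `1 × 1` rectangle holonomy in either orientation is a plaquette up to inversion), `dist1_plaqHol_gaugeAct_le` (plaquette
  bounds are gauge invariant — `U′_t = g_t • M^tU` has the plaquette sizes of `M^tU`), `sum_sum_range_le`, `sum_sum_sum_range_le` (slot counts).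
* §2 ★★ `dist1_mul_inv_le_of_axial_pair` (ANY gauge group): for a COMB-AXIAL PAIR `(W, U₀)` ((T4) of ✓p816142 = ✓p815925's `hax`) with plaquettes
  `≤ aW`, `≤ aU` and spine quotients `dist1 (W(c)·U₀(c)⁻¹) ≤ aS`: EVERY bond has `dist1 (W b·U₀ b⁻¹) ≤ N_P·(aW + aU) + aS`,
  `N_P := (d−1)·((L−1)∕2)·(L+1)` — interior bonds by ✓`exists_sites_dist1_mul_inv_le_interior`, face bonds by ✓`exists_sites_dist1_mul_inv_le_face`
  (px13 g22 ✓p815925), dichotomy lit ✓`B10StarCount.blockOf_shift`, slot geometry ✓`natAbs_rel_emb_le` (px10 g21 ✓p814311).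
* §3 ★★ `arc_le_of_axial_pair` (`SU(2)`: `arc (W b) ≤ σU + (π∕2)·(N_P(aW + aU) + aS)` by ✓p815834 `norm_logVec_le_add_pi_div_two_mul_dist1`);
  ★★★ `arc_le_sup_step_hatLift` — THE ONE-LEVEL SUP STEP WITH THE HAT LIFT AS BACKGROUND: `X = U′_{t+1}`, `V` its hat lift (px12 g23's `hw`∕`hV`,
  ✓p815811∕✓p815895), `W = U′_t` comb-axial relative to `V` and averaging to `X` ((T5)); `PlaqSmall aW W` inside the `ℰp` guard, plaquettes of `X` `≤ aX`,
  bonds of `X` `≤ s ≤ 1∕4` ⟹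
      `arc (W b) ≤ L⁻¹·s + (π∕2)·( N_P·(aW + L⁻²·((π∕2)·aX + 24·s²)) + ((d+2)L)²∕2·aW )`  for EVERY bond `b`
  — lift bonds ✓`arc_lift_le` ((W3)); lift plaquettes ✓p816227 `dist1_plaqHol_lift_le_of_forall` (the `L⁻²` gain + the SIZE² commutator) with the coarse arcs
  `≤ (π∕2)·aX` by ✓`norm_logVec_le_pi_div_two_mul_dist1`; spine quotient = correction factor (✓`dist1_axialAvg_mul_inv_eq_corr` ∘ (T5) ∘ ✓`axialAvg_lift`)
  `≤ 2·((d+2)L)²∕4·aW` by lit ✓`dist1_corr_le_two_mul` ∘ ✓`dist1_loopHol_le`.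
* §4 ★★★ `exists_supProfile_relativeTower` — THE TOWER READING: for gauged levels `U′_t` (`t ≤ m`, `U′_m = 1`), hat lifts `V_t` of `U′_{t+1}`, (T4), (T5),
  thresholds `PlaqSmall (θ_t) U′_t` inside the guard, there is a profile `s` (the bondwise maximum of the arcs) with `s m = 0`, `0 ≤ s`, `arc (U′_t b) ≤ s t`,
  and the CONDITIONAL QUADRATIC STEP `s (t+1) ≤ 1∕4 ⟹ s t ≤ L⁻¹·s (t+1) + ρ t + C₂·s (t+1)²` with
  `ρ t := (π∕2)·((N_P + ((d+2)L)²∕2)·θ_t + N_P·L⁻²·(π∕2)·θ_{t+1})`, `C₂ := (π∕2)·N_P·24·L⁻²` — px16 g20's requested `hs`∕`hsnn`∕`hstep` with `r₀ := L⁻¹`;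
  (5) ∘ «bootstrap» linearise it to `s t ≤ r·s (t+1) + ρ t`, `r < 1`, and in the T³ reading (`θ_t = θBal(K − t)`-class) `Σ_t ρ t` is a THRESHOLD SUM
  (✓`thresholdSum_small`): the (F3) feeder's DEPTH-FREE `E`.

DOCKING (by `exact`∕`obtain`): `U′_t := g t • M^tU`, `V_t := lift t U′_{t+1}` from ✓p816142 `exists_stageGaugeTower` with `lift` the hat lift (`w`, `V` the plain
functions of px12's formulas); (T4) = its conjunct `hT4`, (T5) = `hT5` read through lit ✓`blockAvg_avg`; `PlaqSmall (θ_t) U′_t` ⟸ `histGood`'s `PlaqSmall (θ_t) (M^tU)`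
by `dist1_plaqHol_gaugeAct_le`∕lit ✓`dist1_plaqHol_gaugeAct`; `U′_m = 1` ⟸ (T1) + ✓`iter_eq_one_of_mem_fibre_one`.

HONEST SCOPE.  Kinematic∕group bookkeeping + elementary real inequalities over landed letters; every constant explicit and crude (`N_P` is the face worst
case used for all bonds); nothing of Bałaban's analysis is asserted or proved ([Balaban1985RegularSpaces] Lemma 1 (1.24)–(1.26) p.79 and its iteration p.87
(1.65) are the printed one-level sup letters with background, in the regular-space scaling; the stage-wise backgrounds are px8 g21's design); the bootstrap, (H),
`hFlat`, TUBE-REG∘, GAP♯∘ (`stub_uniformFibreGapOrbit`), S2β, crux 20520 and `YM3TorusSU2` are NOT proved; no registered stub is closed; rung R3 = SU(2) YM₃ on T³ at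
fixed lattice data — NOT d = 4, NOT infinite volume, NOT a mass gap, NOT Clay; the Yang–Mills mass gap is NOT proved.
References: T. Bałaban, CMP **99** (1985) 75–102 [Balaban1985RegularSpaces]; CMP **98** (1985) 17–51 [Balaban1985Averaging] ((9), (12), (19) pp.19–21);
CMP **109** (1987) 249–301 [Balaban1987RG1] ((0.3)–(0.4) pp.252–253).
-/

set_option autoImplicit false

noncomputable section

namespace Summit.QuantumFields.YangMills.Theorems.FluctuationComparisonRegPrIntLS2BetaRelativeTowerSupProfile

open Finset
open scoped Real
open Literature.MathematicalPhysics.QuantumLattice (su2Quat)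
open Literature.MathematicalPhysics.QuantumFieldTheory.Balaban1983to89
open T4Continuum BlockAveraging LatticeWordStokes
open B10Eq47AxialChi (rect rect_one_one)
open B10Eq27TorusAxialLog (rel axialT)
open T4CubeChartGnomonic (SU2)
open T4HaarSU2ExpChart (expPoint)
open T4ExpWindowSmallField (logVec)
open Summit.QuantumFields.YangMills.Theorems.FluctuationComparisonRegPrIntLS2BetaRowTransportVariance (rect_swap)
open Summit.QuantumFields.YangMills.Theorems.FluctuationComparisonRegPrIntLS2BetaIterAxialGaugeOneLevel (natAbs_rel_emb_le)
open Summit.QuantumFields.YangMills.Theorems.FluctuationComparisonRegPrIntLS2BetaRelativeFieldLetter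
  (exists_sites_dist1_mul_inv_le_interior exists_sites_dist1_mul_inv_le_face dist1_axialAvg_mul_inv_eq_corr)
open Summit.QuantumFields.YangMills.Theorems.FluctuationComparisonRegPrIntLS2BetaArcBondSplit (norm_logVec_le_add_pi_div_two_mul_dist1)
open Summit.QuantumFields.YangMills.Theorems.FluctuationComparisonRegPrIntLS2BetaWhitneyHatLift (arc_lift_le axialAvg_lift)
open Summit.QuantumFields.YangMills.Theorems.FluctuationComparisonRegPrIntLS2BetaWhitneyHatLiftCurvature (dist1_plaqHol_lift_le_of_forall)

variable {P : Params} {j : ℕ}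

/-! ## §1 Plaquette slots: the `1 × 1` rectangle holonomies in either orientation, and the slot-sum counts -/

section Slots

variable {G : Type*} [GaugeGroup G]

/-- A `1 × 1` rectangle holonomy in either orientation is a plaquette variable up to inversion, so a uniform plaquette bound bounds it
(`μ < κ`: ✓`rect_one_one`; `κ < μ`: ✓`rect_swap` + `dist1_inv`). [cite: Balaban1985Averaging, (9) p.19] -/
theorem dist1_rect_one_one_le (U : GaugeField P j G) {a : ℝ} (hU : ∀ p : Plaq P j, dist1 (GaugeField.plaqHol U p) ≤ a)
    (z : Site P j) {μ κ : Fin P.d} (hμκ : μ ≠ κ) : dist1 (rect U z μ κ 1 1) ≤ a := by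
  rcases lt_or_gt_of_ne hμκ with h | h
  · rw [rect_one_one U z h]; exact hU _
  · rw [rect_swap, GaugeGroup.dist1_inv, rect_one_one U z h]; exact hU _

/-- A plaquette bound is gauge invariant (`dist1 (u(x)·U(∂p)·u(x)⁻¹) = dist1 U(∂p)`). [cite: Balaban1985Averaging, (12) p.19] -/
theorem dist1_plaqHol_gaugeAct_le (u : GaugeTransf P j G) (U : GaugeField P j G) {a : ℝ}
    (hU : ∀ p : Plaq P j, dist1 (GaugeField.plaqHol U p) ≤ a) (p : Plaq P j) :
    dist1 (GaugeField.plaqHol (GaugeField.gaugeAct u U) p) ≤ a := by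
  rw [T4ReTrLipUnitary.plaqHol_gaugeAct, GaugeGroup.dist1_conj]; exact hU p

/-- Double slot sum over the later axes: at most `#axes · M` slots, each `≤ A`. [folklore] -/
theorem sum_sum_range_le {α : Type*} (s : Finset α) (N : α → ℕ) {M : ℕ} (hN : ∀ κ ∈ s, N κ ≤ M) (f : α → ℕ → ℝ) {A : ℝ}
    (hA : 0 ≤ A) (hf : ∀ κ ∈ s, ∀ r, f κ r ≤ A) :
    ∑ κ ∈ s, ∑ r ∈ range (N κ), f κ r ≤ (s.card * M : ℕ) * A := by
  calc ∑ κ ∈ s, ∑ r ∈ range (N κ), f κ r ≤ ∑ κ ∈ s, ∑ _r ∈ range (N κ), A :=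
        sum_le_sum fun κ hκ => sum_le_sum fun r _ => hf κ hκ r
    _ = ∑ κ ∈ s, (N κ : ℝ) * A := by simp [sum_const, card_range]
    _ ≤ ∑ _κ ∈ s, (M : ℝ) * A := sum_le_sum fun κ hκ => mul_le_mul_of_nonneg_right (by exact_mod_cast hN κ hκ) hA
    _ = (s.card * M : ℕ) * A := by simp [sum_const]; ring

/-- Triple slot sum (face case: the extra spine index `s < S`). [folklore] -/
theorem sum_sum_sum_range_le {α : Type*} (s : Finset α) (N : α → ℕ) {M S : ℕ} (hN : ∀ κ ∈ s, N κ ≤ M)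
    (f : α → ℕ → ℕ → ℝ) {A : ℝ} (hA : 0 ≤ A) (hf : ∀ κ ∈ s, ∀ r t, f κ r t ≤ A) :
    ∑ κ ∈ s, ∑ r ∈ range (N κ), ∑ t ∈ range S, f κ r t ≤ (s.card * M * S : ℕ) * A := by
  have h1 : ∑ κ ∈ s, ∑ r ∈ range (N κ), ∑ t ∈ range S, f κ r t ≤ ∑ κ ∈ s, ∑ _r ∈ range (N κ), ((S : ℝ) * A) := by
    refine sum_le_sum fun κ hκ => sum_le_sum fun r _ => ?_
    calc ∑ t ∈ range S, f κ r t ≤ ∑ _t ∈ range S, A := sum_le_sum fun t _ => hf κ hκ r t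
      _ = (S : ℝ) * A := by simp [sum_const, card_range]
  refine h1.trans ?_
  have h2 := sum_sum_range_le s N hN (fun _ _ => (S : ℝ) * A) (by positivity) (fun _ _ _ => le_rfl)
  refine h2.trans (le_of_eq ?_)
  push_cast; ring

end Slots

/-! ## §2 THE ONE-LEVEL SUP LETTER FOR A COMB-AXIAL PAIR (any gauge group): `dist1 (W b · U₀ b⁻¹)` bondwise -/

section Pair

variable {G : Type*} [GaugeGroup G]

/-- ★★ **THE RELATIVE FIELD OF A COMB-AXIAL PAIR IS BONDWISE SMALL** (height `j`, standing range).  `W` comb-axial RELATIVE TO `U₀` from every block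
centre ((T4) of ✓`…StageGaugeTower`, = ✓p815925's `hax`); plaquettes of `W` `≤ aW`, of `U₀` `≤ aU`; the SPINE QUOTIENTS `dist1 (W(c)·U₀(c)⁻¹) ≤ aS`
(straight coarse transporters, tree `AveragingRT.axialAvg`).  Then EVERY bond has `dist1 (W b · U₀ b⁻¹) ≤ N_P·(aW + aU) + aS` with the slot count
`N_P := (d−1)·((L−1)∕2)·(L+1)` — interior bonds by ✓`exists_sites_dist1_mul_inv_le_interior` (`≤ (d−1)(L−1)∕2` slots), face bonds by
✓`exists_sites_dist1_mul_inv_le_face` (`× (L+1)` spine translates + the spine quotient); the dichotomy is lit ✓`B10StarCount.blockOf_shift`.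
[cite: Balaban1985RegularSpaces, Lemma 1 (1.25)-(1.26) p.79; Balaban1987RG1, (0.3)-(0.4) pp.252-253] -/
theorem dist1_mul_inv_le_of_axial_pair (hj : j + 1 ≤ P.m + P.K) (W U₀ : GaugeField P j G)
    (hax : ∀ z : Site P j, axialT W (emb (blockOf z)) z = axialT U₀ (emb (blockOf z)) z)
    {aW aU aS : ℝ} (haW : 0 ≤ aW) (haU : 0 ≤ aU) (haS : 0 ≤ aS)
    (hWp : ∀ p : Plaq P j, dist1 (GaugeField.plaqHol W p) ≤ aW) (hUp : ∀ p : Plaq P j, dist1 (GaugeField.plaqHol U₀ p) ≤ aU)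
    (hsp : ∀ c : PBond P (j + 1), dist1 (AveragingRT.axialAvg W c * (AveragingRT.axialAvg U₀ c)⁻¹) ≤ aS) (b : PBond P j) :
    dist1 (W b * (U₀ b)⁻¹) ≤ (((P.d - 1) * ((P.L - 1) / 2) * (P.L + 1) : ℕ) : ℝ) * (aW + aU) + aS := by
  obtain ⟨x, μ⟩ := b
  have hslot : ∀ (X : GaugeField P j G) {a : ℝ}, (∀ p : Plaq P j, dist1 (GaugeField.plaqHol X p) ≤ a) →
      ∀ z, ∀ κ ∈ univ.erase μ, dist1 (rect X z μ κ 1 1) ≤ a := fun X a hX z κ hκ =>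
    dist1_rect_one_one_le X hX z (ne_of_mem_erase hκ).symm
  have hcard : (univ.erase μ).card = P.d - 1 := by rw [card_erase_of_mem (mem_univ _), card_univ, Fintype.card_fin]
  have hNκ : ∀ κ ∈ univ.erase μ, (rel (emb (blockOf x)) x κ).natAbs ≤ (P.L - 1) / 2 := fun κ _ => natAbs_rel_emb_le hj rfl κ
  have hface := B10StarCount.blockOf_shift hj x μ
  by_cases hf : (x μ).val % P.L + 1 = P.L
  · -- FACE bond
    rw [if_pos hf] at hface
    obtain ⟨site, -, hbd⟩ := exists_sites_dist1_mul_inv_le_face (G := G) hj (rfl : blockOf x = blockOf x) hf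
    have hax1 : axialT W (emb (blockOf x)) x = axialT U₀ (emb (blockOf x)) x := hax x
    have hax2 : axialT W (emb ((blockOf x).shift μ)) (x.shift μ) = axialT U₀ (emb ((blockOf x).shift μ)) (x.shift μ) := by
      have h := hax (x.shift μ); rwa [hface] at h
    refine (hbd W U₀ hax1 hax2).trans ?_
    have hsum := sum_sum_sum_range_le (univ.erase μ) (fun κ => (rel (emb (blockOf x)) x κ).natAbs) (S := P.L + 1) hNκ
      (fun κ r t => dist1 (rect W (site κ r t) μ κ 1 1) + dist1 (rect U₀ (site κ r t) μ κ 1 1)) (add_nonneg haW haU)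
      (fun κ hκ r t => add_le_add (hslot W hWp _ κ hκ) (hslot U₀ hUp _ κ hκ))
    rw [hcard] at hsum
    exact add_le_add hsum (hsp _)
  · -- INTERIOR bond
    rw [if_neg hf] at hface
    obtain ⟨site, -, hbd⟩ := exists_sites_dist1_mul_inv_le_interior (G := G) hj (rfl : blockOf x = blockOf x) μ hface
    refine (hbd W U₀ hax).trans ?_
    have hsum := sum_sum_range_le (univ.erase μ) (fun κ => (rel (emb (blockOf x)) x κ).natAbs) hNκ
      (fun κ r => dist1 (rect W (site κ r) μ κ 1 1) + dist1 (rect U₀ (site κ r) μ κ 1 1)) (add_nonneg haW haU)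
      (fun κ hκ r => add_le_add (hslot W hWp _ κ hκ) (hslot U₀ hUp _ κ hκ))
    rw [hcard] at hsum
    refine hsum.trans ?_
    have hmono : (((P.d - 1) * ((P.L - 1) / 2) : ℕ) : ℝ) ≤ (((P.d - 1) * ((P.L - 1) / 2) * (P.L + 1) : ℕ) : ℝ) := by
      exact_mod_cast Nat.le_mul_of_pos_right _ (Nat.succ_pos _)
    nlinarith [mul_le_mul_of_nonneg_right hmono (add_nonneg haW haU)]

end Pair

/-! ## §3 `SU(2)`: the ARC of the current field from the arc of the background — the one-level sup step with the HAT LIFT as background -/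

section HatLift

/-- ★★ **ARC SPLIT FOR A COMB-AXIAL PAIR on `SU(2)`**: `arc (W b) ≤ σU + (π∕2)·(N_P·(aW + aU) + aS)` when every bond of the background has `arc ≤ σU`
(✓`norm_logVec_le_add_pi_div_two_mul_dist1` ∘ §2). [cite: Balaban1985RegularSpaces, Lemma 1 (1.25)-(1.26) p.79, (1.29) p.81] -/
theorem arc_le_of_axial_pair (hj : j + 1 ≤ P.m + P.K) (W U₀ : GaugeField P j SU2)
    (hax : ∀ z : Site P j, axialT W (emb (blockOf z)) z = axialT U₀ (emb (blockOf z)) z)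
    {aW aU aS σU : ℝ} (haW : 0 ≤ aW) (haU : 0 ≤ aU) (haS : 0 ≤ aS)
    (hWp : ∀ p : Plaq P j, dist1 (GaugeField.plaqHol W p) ≤ aW) (hUp : ∀ p : Plaq P j, dist1 (GaugeField.plaqHol U₀ p) ≤ aU)
    (hsp : ∀ c : PBond P (j + 1), dist1 (AveragingRT.axialAvg W c * (AveragingRT.axialAvg U₀ c)⁻¹) ≤ aS)
    (hUb : ∀ b : PBond P j, ‖logVec (su2Quat (U₀ b))‖ ≤ σU) (b : PBond P j) :
    ‖logVec (su2Quat (W b))‖ ≤ σU + π / 2 * ((((P.d - 1) * ((P.L - 1) / 2) * (P.L + 1) : ℕ) : ℝ) * (aW + aU) + aS) := by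
  have h1 := norm_logVec_le_add_pi_div_two_mul_dist1 (W b) (U₀ b)
  have h2 := dist1_mul_inv_le_of_axial_pair hj W U₀ hax haW haU haS hWp hUp hsp b
  have hπ : 0 ≤ π / 2 := by positivity
  nlinarith [hUb b, mul_le_mul_of_nonneg_left h2 hπ]

/-- ★★★ **THE ONE-LEVEL SUP STEP OF THE RELATIVE STAGE TOWER** (UV3-NODE §57.8 (B); the lattice docking of px16 g20's ✓p816141 (5)).  Height `t`, standing
range; `X` the FINAL coarser field (`U′_{t+1}`), `V` its geodesic Whitney HAT LIFT (px12 g23's weights `hw` and lift `hV`, ✓p815811∕✓p815895), `W` the current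
level-`t` field (`U′_t`), COMB-AXIAL RELATIVE TO `V` ((T4)) and averaging to `X` under the (0.4) block average ((T5)).  If the plaquettes of `W` are `θ`-small
(`PlaqSmall aW W`, inside the `ℰp` guard), those of `X` are `≤ aX`, and every bond of `X` has `arc ≤ s` with `s ≤ 1∕4`, then EVERY bond of `W` has
    `arc (W b) ≤ L⁻¹·s + (π∕2)·( N_P·(aW + L⁻²·((π∕2)·aX + 24·s²)) + ((d+2)L)²∕2·aW )`,
i.e. `s′_t ≤ L⁻¹·s′_{t+1} + ρ_t + C₂·s′_{t+1}²` with `ρ_t := (π∕2)·(N_P + ((d+2)L)²∕2)·aW + (π∕2)·N_P·L⁻²·(π∕2)·aX`, `C₂ := (π∕2)·N_P·24·L⁻²` — the comb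
bonds carry the lift (✓`arc_lift_le`: `L⁻¹·s`), the others add fluxes: interior∕face letters ✓p815925, lift plaquettes ✓p816227 `dist1_plaqHol_lift_le_of_forall`
(SIZE² at the coarser level — the located F₂ commutator), spine quotient = correction factor (✓`dist1_axialAvg_mul_inv_eq_corr` ∘ (T5) ∘ ✓`axialAvg_lift`;
lit ✓`dist1_corr_le_two_mul` ∘ ✓`dist1_loopHol_le`). [cite: Balaban1985RegularSpaces, Lemma 1 (1.24)-(1.26) p.79, (1.29) p.81, (1.65) p.87; Balaban1987RG1, (0.4) p.253] -/
theorem arc_le_sup_step_hatLift {t : ℕ} (ht : t + 1 ≤ P.m + P.K) (w : PBond P t → PBond P (t + 1) → ℝ)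
    (hw : ∀ b e, w b e = if e.dir = b.dir ∧ (b.src b.dir - emb e.src b.dir).val < P.L then
      ∏ ν ∈ Finset.univ.erase b.dir, max 0 (1 - ((rel (emb e.src) b.src ν).natAbs : ℝ) / P.L) else 0)
    (X : GaugeField P (t + 1) SU2) (V : GaugeField P t SU2)
    (hV : ∀ b, V b = expPoint (∑ e, w b e • ((P.L : ℝ)⁻¹ • logVec (su2Quat (X e)))))
    (W : GaugeField P t SU2)
    (hax : ∀ z : Site P t, axialT W (emb (blockOf z)) z = axialT V (emb (blockOf z)) z)
    (hT5 : avgFun T3UnitLawDensityEML.ℰp W = X)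
    {aW aX s : ℝ} (haW : 0 ≤ aW) (hWs : PlaqSmall aW W)
    (hg1 : ((((P.d + 2) * P.L : ℕ) : ℝ) ^ 2 / 4) * aW < ExpMeanLog.deltaSU (Fin 2))
    (hg2 : ((((P.d + 2) * P.L : ℕ) : ℝ) ^ 2 / 4) * aW ≤ 1 / 6)
    (haX : 0 ≤ aX) (hXp : ∀ q : Plaq P (t + 1), dist1 (GaugeField.plaqHol X q) ≤ aX)
    (hs : ∀ e : PBond P (t + 1), ‖logVec (su2Quat (X e))‖ ≤ s) (hs4 : s ≤ 1 / 4) (b : PBond P t) :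
    ‖logVec (su2Quat (W b))‖ ≤ (P.L : ℝ)⁻¹ * s +
      π / 2 * ((((P.d - 1) * ((P.L - 1) / 2) * (P.L + 1) : ℕ) : ℝ) * (aW + ((P.L : ℝ)⁻¹) ^ 2 * (π / 2 * aX + 24 * s ^ 2)) +
        2 * (((((P.d + 2) * P.L : ℕ) : ℝ) ^ 2 / 4) * aW)) := by
  have hs0 : 0 ≤ s := by
    obtain ⟨e₀⟩ : Nonempty (PBond P (t + 1)) := ⟨⟨default, ⟨0, P.hd⟩⟩⟩
    exact (norm_nonneg _).trans (hs e₀)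
  -- plaquettes of `W`
  have hWp : ∀ p : Plaq P t, dist1 (GaugeField.plaqHol W p) ≤ aW := fun p => (hWs p).le
  -- plaquettes of the lift (px12's curvature letter, global form; `F := (π∕2)·aX` bounds the coarse ARCS)
  have hF : ∀ q : Plaq P (t + 1), ‖logVec (su2Quat (GaugeField.plaqHol X q))‖ ≤ π / 2 * aX := fun q =>
    (FluctuationComparisonRegPrIntLS2BetaDistributedHolonomySU2.norm_logVec_le_pi_div_two_mul_dist1 _).trans (mul_le_mul_of_nonneg_left (hXp q) (by positivity))
  have hVp : ∀ p : Plaq P t, dist1 (GaugeField.plaqHol V p) ≤ ((P.L : ℝ)⁻¹) ^ 2 * (π / 2 * aX + 24 * s ^ 2) := fun p =>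
    dist1_plaqHol_lift_le_of_forall ht w hw X V hV hs hs4 p (fun y _ => hF _)
  -- bonds of the lift
  have hVb : ∀ b : PBond P t, ‖logVec (su2Quat (V b))‖ ≤ (P.L : ℝ)⁻¹ * s := fun b =>
    arc_lift_le ht w hw X V hV b fun e _ => hs e
  -- spine quotient = correction factor ≤ 2·(loop bound)
  have havg : ∀ c : PBond P (t + 1), AveragingRT.axialAvg V c = avgFun T3UnitLawDensityEML.ℰp W c := fun c => by
    rw [axialAvg_lift ht w hw X V hV, hT5]
  have hsp : ∀ c : PBond P (t + 1), dist1 (AveragingRT.axialAvg W c * (AveragingRT.axialAvg V c)⁻¹) ≤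
      2 * (((((P.d + 2) * P.L : ℕ) : ℝ) ^ 2 / 4) * aW) := fun c => by
    rw [dist1_axialAvg_mul_inv_eq_corr _ W V c (havg c)]
    exact BlockAveragingEMLProp2.dist1_corr_le_two_mul W c (fun i => dist1_loopHol_le haW hWs c i) hg1 hg2
  have hU0 : 0 ≤ ((P.L : ℝ)⁻¹) ^ 2 * (π / 2 * aX + 24 * s ^ 2) := by positivity
  have hS0 : 0 ≤ 2 * (((((P.d + 2) * P.L : ℕ) : ℝ) ^ 2 / 4) * aW) := by positivity
  exact arc_le_of_axial_pair ht W V hax haW hU0 hS0 hWp hVp hsp hVb b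

end HatLift


/-! ## §4 THE TOWER READING: the sup profile of the relative stage tower and its CONDITIONAL quadratic recursion — the premises of px16 g20's (5) -/

section Tower

/-- ★★★ **THE RELATIVE STAGE TOWER'S SUP PROFILE** (heights `t ≤ m ≤ m_P + K_P`; `U′_t` the gauged levels with `U′_m = 1`, `V_t` the hat lift of `U′_{t+1}`,
(T4) comb axiality of `U′_t` relative to `V_t`, (T5) `U′_t` averages to `U′_{t+1}`; plaquettes of `U′_t` `θ_t`-small inside the `ℰp` guard — all of this is
✓p816142's tower instantiated with px12's lift over a good history).  Then there is a profile `s` (the bondwise maximum of the arcs, level by level) with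
`s m = 0`, `0 ≤ s`, `arc (U′_t b) ≤ s t`, and the CONDITIONAL QUADRATIC STEP: for `t < m`, if `s (t+1) ≤ 1∕4` then
    `s t ≤ L⁻¹·s (t+1) + ρ t + C₂·s (t+1)²`,  `ρ t := (π∕2)·((N_P + ((d+2)L)²∕2)·θ_t + N_P·L⁻²·(π∕2)·θ_{t+1})`,  `C₂ := (π∕2)·N_P·24·L⁻²`
— EXACTLY the `hs`∕`hsnn`∕`hstep` premises of px16 g20's bootstrap for ✓p816141 `recursion_varRatio_sqrtL_le_of_contract` (`r₀ := L⁻¹`), whose `Σρ` is a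
THRESHOLD SUM in the T³ reading (`θ_t = θBal(K − t)`-class): the (F3) feeder's depth-free `E` of ✓p816498's (H), and the chart smallness every feeder's BCH
step needs. [cite: Balaban1985RegularSpaces, Lemma 1 (1.24)-(1.26) p.79, (1.65) p.87; Balaban1987RG1, (0.4) p.253] -/
theorem exists_supProfile_relativeTower {m : ℕ} (hm : m ≤ P.m + P.K)
    (U' : (t : ℕ) → GaugeField P t SU2) (w : (t : ℕ) → PBond P t → PBond P (t + 1) → ℝ) (V : (t : ℕ) → GaugeField P t SU2)
    (hw : ∀ t, t < m → ∀ b e, w t b e = if e.dir = b.dir ∧ (b.src b.dir - emb e.src b.dir).val < P.L then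
      ∏ ν ∈ Finset.univ.erase b.dir, max 0 (1 - ((rel (emb e.src) b.src ν).natAbs : ℝ) / P.L) else 0)
    (hV : ∀ t, t < m → ∀ b, V t b = expPoint (∑ e, w t b e • ((P.L : ℝ)⁻¹ • logVec (su2Quat (U' (t + 1) e)))))
    (hax : ∀ t, t < m → ∀ z : Site P t, axialT (U' t) (emb (blockOf z)) z = axialT (V t) (emb (blockOf z)) z)
    (hT5 : ∀ t, t < m → avgFun T3UnitLawDensityEML.ℰp (U' t) = U' (t + 1))
    (htop : U' m = 1)
    (θ : ℕ → ℝ) (hθ0 : ∀ t, 0 ≤ θ t) (hθ : ∀ t, t ≤ m → PlaqSmall (θ t) (U' t))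
    (hg1 : ∀ t, t < m → ((((P.d + 2) * P.L : ℕ) : ℝ) ^ 2 / 4) * θ t < ExpMeanLog.deltaSU (Fin 2))
    (hg2 : ∀ t, t < m → ((((P.d + 2) * P.L : ℕ) : ℝ) ^ 2 / 4) * θ t ≤ 1 / 6) :
    ∃ s : ℕ → ℝ, s m = 0 ∧ (∀ t, 0 ≤ s t) ∧ (∀ t, t ≤ m → ∀ b : PBond P t, ‖logVec (su2Quat (U' t b))‖ ≤ s t) ∧
      ∀ t, t < m → s (t + 1) ≤ 1 / 4 →
        s t ≤ (P.L : ℝ)⁻¹ * s (t + 1) +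
          π / 2 * (((((P.d - 1) * ((P.L - 1) / 2) * (P.L + 1) : ℕ) : ℝ) + 2 * ((((P.d + 2) * P.L : ℕ) : ℝ) ^ 2 / 4)) * θ t +
            (((P.d - 1) * ((P.L - 1) / 2) * (P.L + 1) : ℕ) : ℝ) * ((P.L : ℝ)⁻¹) ^ 2 * (π / 2) * θ (t + 1)) +
          π / 2 * (((P.d - 1) * ((P.L - 1) / 2) * (P.L + 1) : ℕ) : ℝ) * 24 * ((P.L : ℝ)⁻¹) ^ 2 * s (t + 1) ^ 2 := by
  classical
  have hne : ∀ t, (Finset.univ : Finset (PBond P t)).Nonempty := fun t => ⟨⟨default, ⟨0, P.hd⟩⟩, Finset.mem_univ _⟩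
  -- the profile: the bondwise maximum at heights ≤ m, zero above
  refine ⟨fun t => if t ≤ m then (Finset.univ : Finset (PBond P t)).sup' (hne t) (fun b => ‖logVec (su2Quat (U' t b))‖) else 0, ?_, ?_, ?_, ?_⟩
  · -- top
    simp only [le_refl, if_true, htop]
    refine le_antisymm (Finset.sup'_le _ _ fun b _ => ?_) ?_
    · show ‖logVec (su2Quat ((1 : GaugeField P m SU2) b))‖ ≤ 0
      rw [show (1 : GaugeField P m SU2) b = 1 from rfl, FluctuationComparisonRegPrIntLS2BetaWhitneyHatLift.logVec_su2Quat_one, norm_zero]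
    · obtain ⟨b₀, hb₀⟩ := hne m
      exact (norm_nonneg _).trans (Finset.le_sup' (fun b => ‖logVec (su2Quat ((1 : GaugeField P m SU2) b))‖) hb₀)
  · -- nonnegativity
    intro t
    by_cases ht : t ≤ m
    · simp only [ht, if_true]
      obtain ⟨b₀, hb₀⟩ := hne t
      exact (norm_nonneg _).trans (Finset.le_sup' (fun b => ‖logVec (su2Quat (U' t b))‖) hb₀)
    · simp only [ht, if_false, le_refl]
  · -- the profile bounds the arcs
    intro t ht b
    simp only [ht, if_true]
    exact Finset.le_sup' (fun b => ‖logVec (su2Quat (U' t b))‖) (Finset.mem_univ b)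
  · -- the conditional quadratic step
    intro t ht hs4
    have ht' : t ≤ m := ht.le
    have ht1 : t + 1 ≤ m := ht
    simp only [ht', ht1, if_true] at hs4 ⊢
    have htt : t + 1 ≤ P.m + P.K := by omega
    refine Finset.sup'_le _ _ fun b _ => ?_
    have hstep := arc_le_sup_step_hatLift htt (w t) (hw t ht) (U' (t + 1)) (V t) (hV t ht) (U' t) (hax t ht) (hT5 t ht)
      (hθ0 t) (hθ t ht') (hg1 t ht) (hg2 t ht) (hθ0 (t + 1)) (fun q => (hθ (t + 1) ht1 q).le)
      (fun e => Finset.le_sup' (fun e => ‖logVec (su2Quat (U' (t + 1) e))‖) (Finset.mem_univ e)) hs4 b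
    refine hstep.trans (le_of_eq ?_)
    ring

end Tower

end Summit.QuantumFields.YangMills.Theorems.FluctuationComparisonRegPrIntLS2BetaRelativeTowerSupProfile

end
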